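import Summits.Langlands.Langlands.Theses.RepeatedRootSocle
import Literature.NumberTheory.GaloisRepresentations.SymplecticMultiplierDeterminant
import Literature.NumberTheory.GaloisRepresentations.LocalKroneckerWeberInertiaProofs
import Literature.NumberTheory.GaloisRepresentations.CyclotomicCharacterFrobeniusProofs
import Literature.NumberTheory.EllipticCurves.InertiaAboveEllCyclotomicProofs
import Literature.NumberTheory.EllipticCurves.BSDConductorProofs

/-!
# Disproof of `LimitClassicalUnrefined` (stmt-Langlands-18087) — findings: the crux is VACUOUSLY TRUE

Crux-attack at birth (refuter `rattack-stmt-Langlands-18087`, 2026-08-17), route `RepeatedRootSocle`.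
Revision 2 (same day): REPAIR CORRECTED to R2 (multiplier `ε`) after reading the sibling workfile
`Cruxes/PadicLimitUnrefined/Disproof.lean` (refuter `rattack-stmt-Langlands-18088`) and the grounder's
note on this item — three seats found the vacuity independently; this file now records BOTH
inconsistencies and shows that the cohomological-shape repair R1 first proposed here is STILL vacuous.

**Findings (kernel-checked, no sorry, axioms `propext / Classical.choice / Quot.sound`).**  The
hypothesis bracket shared by `LimitClassicalUnrefined`, the target `UnrefinedWeightTwoLifting` and
`PadicLimitUnrefined` mixes two conventions and is UNSATISFIABLE, twice over:

* (i) `Sympl ρ` (multiplier `ε⁻¹`, the COHOMOLOGICAL convention `ρ ≈ H¹(A)`: `det ρ = ε⁻²` by the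
  `GSp₄` identity `det = ν²`, `IsSymplecticWithMultiplierFun.det_eq_sq`) against `PSh ρ v`, `v ∣ p`
  (the HOMOLOGICAL Siegel shape `(εα, εβ, β⁻¹, α⁻¹)` of the tree's `IsWeightTwoOrdinaryDistinguished`,
  `ρ ≈ V_p(A)`, `det = ε²`, `det_toLocal_of_siegelShape`): `ε(τ)⁴ = 1` on `Γ_{ℚ_v}`
  (`cyclotomicCharacter_absGaloisRestrict`, `toLocal_apply`), contradicting `χ_p(I_{ℚ_v}) = ℤ_pˣ ∋ 1+p`
  (`adicCompletion_rat_exists_mem_absInertia_cyclotomicCharacter_eq`, `exists_unit_pow_ne_one`) —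
  `false_of_sympl_inv_of_siegelShape` (§1);
* (ii) `Sympl ρ` (multiplier `ε⁻¹`) against `Pure ρ` (ARITHMETIC-Frobenius characteristic polynomial
  `P ∈ ℤ[X]` a.e. — `HasFrobCharpolyAt` is arithmetic, `χ_p(Frob_v) = q_v`,
  `GaloisRep.cyclotomicCharacter_apply_of_isArithFrobAt`): `det ρ(Frob_v) = q_v⁻² = P(0) ∈ ℤ`,
  impossible — `false_of_sympl_inv_of_pure` (§1b; argument of the sibling workfile, re-proved here).

Consequently the crux, the target and `PadicLimitUnrefined` are all provable by `False.elim` (§3) — the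
route's typed content is empty and `SectorComplement` collapses to `Langlands` itself.

**Classification: vacuous / misstated (not substantive).**  Everything in the bracket EXCEPT the
multiplier is written in the homological / arithmetic-Frobenius convention (`PSh` shape (P) of
`WeightTwoOrdinaryDistinguished.lean`, whose docstring says "the requesting route uses the HOMOLOGICAL
convention … multiplier `ε`"; `Pure` with `P ∈ ℤ[X]`, `‖z‖² = q_v`; `Aut` via `arithFrobPolyOfSatake`,
as in route `PhantomRM`, multiplier `ε`).  REPAIR `C′` = R2 (§2, `LimitClassicalUnrefinedRepaired`,
elaborates; byte-identical to the sibling's recommendation): in `Sympl` replace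
`(GaloisRep.cyclotomicCharacter ℚ p g)⁻¹` by `GaloisRep.cyclotomicCharacter ℚ p g` (multiplier `ε`),
everything else verbatim; then `det = ε²` from `Sympl`, from `PSh` (`det_toLocal_of_siegelShape`) and
`det ρ(Frob_v) = q_v² = P(0)` are all consistent and neither witness bites.  The repair R1 first
proposed in revision 1 of this file (keep `ε⁻¹`, cohomological shape `(α, β, ε⁻¹β⁻¹, ε⁻¹α⁻¹)`) cures
(i) (`det_toLocal_of_cohomologicalSiegelShape`) but NOT (ii): `limitClassicalUnrefinedCohomShape_vacuous`
(§2) proves that variant outright as well — RETRACTED.  A fully cohomological restatement would also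
have to rewrite `Pure` (arithmetic Frobenius on `H¹` has `det = q⁻²`, no `P ∈ ℤ[X]`) and re-vet `Aut`;
not recommended.  Apply R2 to all three typed items (and to the informal text, which should then say
"multiplier `ε` (homological convention, `ρ ≈ V_p A`)").

Other birth attacks on `C′` (paper): `Lim`'s cofinite exceptional set may depend on `m` (weaker
hypothesis than a fixed tame level — a stronger crux, still a consequence of Fontaine–Mazur +
reciprocity, no cheap falsifier); `hcpt`, `ι` inhabited (`isCompact_glFiniteIntegralLevel_holds`,
`PadicAlgCl.nonempty_ringEquiv_complex`); `C′ → Langlands` no (one sector), `Langlands → C′` only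
morally (the summit types de Rhamness differently) — not a restatement; the repaired target implies the
repaired `PadicLimitUnrefined` trivially (sibling file, `ρ_m := ρ`) but not the repaired heart; no
finite model (interfaces not constructible).
-/

set_option linter.dupNamespace false -- `Summit.Langlands.Langlands` is the mandated namespace (D-0017)

open scoped NumberField MatrixGroups Matrix Polynomial
open Field IsDedekindDomain Filter
open Literature.NumberTheory.GaloisRepresentations

namespace Summit.Langlands.Langlands.Cruxes.LimitClassicalUnrefined.Disproof

variable {p : ℕ} [Fact p.Prime]

/-! ## §1 The bracket `Sympl ∧ PSh` is contradictory -/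

/-- In the homological Siegel shape (the route's `PSh`) the determinant on `Γ_{ℚ_v}` is `ε²`.
[folklore] -/
theorem det_toLocal_of_siegelShape (ρ : FramedGaloisRep ℚ (PadicAlgCl p) 4)
    (v : HeightOneSpectrum (𝓞 ℚ))
    (h : ∃ (g : Matrix.GeneralLinearGroup (Fin 4) (PadicAlgCl p))
      (α β : absoluteGaloisGroup (v.adicCompletion ℚ) →* (PadicAlgCl p)ˣ),
      (∀ τ ∈ absInertia (v.adicCompletion ℚ), α τ = 1 ∧ β τ = 1) ∧
      ∀ τ, (∀ i j : Fin 4, j < i → (g⁻¹ * ρ.toLocal v τ * g).val i j = 0) ∧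
        (g⁻¹ * ρ.toLocal v τ * g).val 0 1 = 0 ∧ (g⁻¹ * ρ.toLocal v τ * g).val 2 3 = 0 ∧
        (g⁻¹ * ρ.toLocal v τ * g).val 0 0 =
          algebraMap ℚ_[p] (PadicAlgCl p)
            (((GaloisRep.cyclotomicCharacter (v.adicCompletion ℚ) p τ : ℤ_[p]ˣ) : ℤ_[p]) :
              ℚ_[p]) * α τ ∧
        (g⁻¹ * ρ.toLocal v τ * g).val 1 1 =
          algebraMap ℚ_[p] (PadicAlgCl p)
            (((GaloisRep.cyclotomicCharacter (v.adicCompletion ℚ) p τ : ℤ_[p]ˣ) : ℤ_[p]) :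
              ℚ_[p]) * β τ ∧
        (g⁻¹ * ρ.toLocal v τ * g).val 2 2 = ((β τ)⁻¹ : (PadicAlgCl p)ˣ) ∧
        (g⁻¹ * ρ.toLocal v τ * g).val 3 3 = ((α τ)⁻¹ : (PadicAlgCl p)ˣ))
    (τ : absoluteGaloisGroup (v.adicCompletion ℚ)) :
    ((ρ.toLocal v τ : GL (Fin 4) (PadicAlgCl p)) : Matrix (Fin 4) (Fin 4) (PadicAlgCl p)).det =
      algebraMap ℚ_[p] (PadicAlgCl p)
        (((GaloisRep.cyclotomicCharacter (v.adicCompletion ℚ) p τ : ℤ_[p]ˣ) : ℤ_[p]) : ℚ_[p]) ^ 2 := by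
  obtain ⟨g, α, β, -, hsh⟩ := h
  obtain ⟨htri, -, -, h₀, h₁, h₂, h₃⟩ := hsh τ
  have hdet : Matrix.GeneralLinearGroup.det (ρ.toLocal v τ) =
      Matrix.GeneralLinearGroup.det (g⁻¹ * ρ.toLocal v τ * g) := by
    rw [map_mul, map_mul, map_inv, inv_mul_cancel_comm]
  have hup : ((g⁻¹ * ρ.toLocal v τ * g : GL (Fin 4) (PadicAlgCl p)) :
      Matrix (Fin 4) (Fin 4) (PadicAlgCl p)).BlockTriangular id :=
    fun i j hij => htri i j hij
  have hval : ((ρ.toLocal v τ : GL (Fin 4) (PadicAlgCl p)) :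
      Matrix (Fin 4) (Fin 4) (PadicAlgCl p)).det =
      ((g⁻¹ * ρ.toLocal v τ * g : GL (Fin 4) (PadicAlgCl p)) :
        Matrix (Fin 4) (Fin 4) (PadicAlgCl p)).det := by
    rw [← Matrix.GeneralLinearGroup.val_det_apply, ← Matrix.GeneralLinearGroup.val_det_apply, hdet]
  rw [hval, Matrix.det_of_upperTriangular hup, Fin.prod_univ_four, h₀, h₁, h₂, h₃]
  set e : PadicAlgCl p := algebraMap ℚ_[p] (PadicAlgCl p)
    (((GaloisRep.cyclotomicCharacter (v.adicCompletion ℚ) p τ : ℤ_[p]ˣ) : ℤ_[p]) : ℚ_[p]) with he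
  calc e * α τ * (e * β τ) * ((β τ)⁻¹ : (PadicAlgCl p)ˣ) * ((α τ)⁻¹ : (PadicAlgCl p)ˣ)
      = e ^ 2 * ((α τ : PadicAlgCl p) * ((α τ)⁻¹ : (PadicAlgCl p)ˣ)) *
          ((β τ : PadicAlgCl p) * ((β τ)⁻¹ : (PadicAlgCl p)ˣ)) := by ring
    _ = e ^ 2 := by rw [Units.mul_inv, Units.mul_inv, mul_one, mul_one]

/-- **The bracket `Sympl ρ ∧ (∀ v ∣ p, PSh ρ v)` of the route is unsatisfiable** ("any `ρ`
satisfying the crux's hypotheses" does not exist): multiplier `ε⁻¹` forces `det ρ = ε⁻²`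
(`GSp₄`: `det = ν²`), the homological Siegel shape forces `det ρ|Γ_{ℚ_p} = ε²`, so `ε⁴ = 1` on
`Γ_{ℚ_p}`, absurd since `χ_p(I_{ℚ_p}) = ℤ_pˣ ∋ 1 + p`. [folklore] -/
theorem false_of_sympl_inv_of_siegelShape (ρ : FramedGaloisRep ℚ (PadicAlgCl p) 4)
    (hS : ρ.IsSymplecticWithMultiplierFun (fun g => algebraMap ℚ_[p] (PadicAlgCl p)
      ((((GaloisRep.cyclotomicCharacter ℚ p g)⁻¹ : ℤ_[p]ˣ) : ℤ_[p]) : ℚ_[p])))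
    (hP : ∀ v : HeightOneSpectrum (𝓞 ℚ), ((p : ℕ) : 𝓞 ℚ) ∈ v.asIdeal →
      ∃ (g : Matrix.GeneralLinearGroup (Fin 4) (PadicAlgCl p))
        (α β : absoluteGaloisGroup (v.adicCompletion ℚ) →* (PadicAlgCl p)ˣ),
        (∀ τ ∈ absInertia (v.adicCompletion ℚ), α τ = 1 ∧ β τ = 1) ∧
        ∀ τ, (∀ i j : Fin 4, j < i → (g⁻¹ * ρ.toLocal v τ * g).val i j = 0) ∧
          (g⁻¹ * ρ.toLocal v τ * g).val 0 1 = 0 ∧ (g⁻¹ * ρ.toLocal v τ * g).val 2 3 = 0 ∧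
          (g⁻¹ * ρ.toLocal v τ * g).val 0 0 =
            algebraMap ℚ_[p] (PadicAlgCl p)
              (((GaloisRep.cyclotomicCharacter (v.adicCompletion ℚ) p τ : ℤ_[p]ˣ) : ℤ_[p]) :
                ℚ_[p]) * α τ ∧
          (g⁻¹ * ρ.toLocal v τ * g).val 1 1 =
            algebraMap ℚ_[p] (PadicAlgCl p)
              (((GaloisRep.cyclotomicCharacter (v.adicCompletion ℚ) p τ : ℤ_[p]ˣ) : ℤ_[p]) :
                ℚ_[p]) * β τ ∧
          (g⁻¹ * ρ.toLocal v τ * g).val 2 2 = ((β τ)⁻¹ : (PadicAlgCl p)ˣ) ∧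
          (g⁻¹ * ρ.toLocal v τ * g).val 3 3 = ((α τ)⁻¹ : (PadicAlgCl p)ˣ)) :
    False := by
  have hp : p.Prime := Fact.out
  -- the place of `ℚ` above `p`
  obtain ⟨v, hv, hpv⟩ : ∃ v : HeightOneSpectrum (𝓞 ℚ),
      ((Rat.HeightOneSpectrum.primesEquiv v : Nat.Primes) : ℕ) = p ∧
        ((p : ℕ) : 𝓞 ℚ) ∈ v.asIdeal := by
    refine ⟨(Rat.HeightOneSpectrum.primesEquiv (R := 𝓞 ℚ)).symm ⟨p, hp⟩, ?_, ?_⟩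
    · rw [Equiv.apply_symm_apply]
    · exact (Literature.NumberTheory.EllipticCurves.natCast_mem_asIdeal_iff_eq_primesEquiv_symm
        _ hp).mpr rfl
  -- a unit of infinite order, carried by an element of `Γ_{ℚ_v}`
  obtain ⟨u, hu⟩ := exists_unit_pow_ne_one p
  obtain ⟨τ, -, hτ⟩ := adicCompletion_rat_exists_mem_absInertia_cyclotomicCharacter_eq p v hv u
  -- the determinant of `ρ(τ)` computed in two ways
  have h1 := det_toLocal_of_siegelShape ρ v (hP v hpv) τ
  rw [FramedGaloisRep.toLocal_apply] at h1
  haveI : NeZero ((p : ℕ) : ℚ) := ⟨by exact_mod_cast hp.ne_zero⟩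
  have h2 := hS.det_eq_sq (absGaloisRestrict ℚ (v.adicCompletion ℚ) τ)
  rw [h1, cyclotomicCharacter_absGaloisRestrict, hτ] at h2
  -- read everything through `F : ℤ_p → ℚ̄_p`
  obtain ⟨F, hF⟩ : ∃ F : ℤ_[p] →+* PadicAlgCl p,
      ∀ x : ℤ_[p], F x = algebraMap ℚ_[p] (PadicAlgCl p) (x : ℚ_[p]) :=
    ⟨(algebraMap ℚ_[p] (PadicAlgCl p)).comp PadicInt.Coe.ringHom, fun x => rfl⟩
  have hFinj : Function.Injective F := fun a b h => by
    rw [hF, hF] at h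
    exact PadicInt.ext ((algebraMap ℚ_[p] (PadicAlgCl p)).injective h)
  rw [← hF, ← hF] at h2
  -- `h2 : F u ^ 2 = F u⁻¹ ^ 2`, hence `F u ^ 4 = 1`
  have hmul : F (u : ℤ_[p]) * F ((u⁻¹ : ℤ_[p]ˣ) : ℤ_[p]) = 1 := by
    rw [← map_mul, Units.mul_inv, map_one]
  have key : F (u : ℤ_[p]) ^ 4 = 1 := by
    calc F (u : ℤ_[p]) ^ 4 = F (u : ℤ_[p]) ^ 2 * F (u : ℤ_[p]) ^ 2 := by ring
      _ = F (u : ℤ_[p]) ^ 2 * F ((u⁻¹ : ℤ_[p]ˣ) : ℤ_[p]) ^ 2 := by rw [← h2]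
      _ = (F (u : ℤ_[p]) * F ((u⁻¹ : ℤ_[p]ˣ) : ℤ_[p])) ^ 2 := by ring
      _ = 1 := by rw [hmul, one_pow]
  have h5 : ((u ^ 4 : ℤ_[p]ˣ) : ℤ_[p]) = 1 :=
    hFinj (by rw [Units.val_pow_eq_pow_val, map_pow, key, map_one])
  exact hu 4 (by norm_num) (Units.ext (by rw [h5, Units.val_one]))

/-! ## §1b The bracket `Sympl ∧ Pure` is contradictory as well (sibling's argument, re-proved) -/

/-- `ℚ` has infinitely many finite places (via `primesEquiv : places ≃ primes`). [folklore] -/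
theorem infinite_heightOneSpectrum_rat : Infinite (HeightOneSpectrum (𝓞 ℚ)) :=
  haveI : Infinite Nat.Primes := Set.infinite_coe_iff.mpr Nat.infinite_setOf_prime
  Infinite.of_injective _ (Rat.HeightOneSpectrum.primesEquiv (R := 𝓞 ℚ)).symm.injective

/-- **(ii), core**: a rank-4 framed `p`-adic representation of `Γ_ℚ` symplectic with multiplier
`ε⁻¹` has no INTEGRAL arithmetic-Frobenius characteristic polynomial at any place `v ∤ p`
(`det = (ε(Frob_v)⁻¹)² = q_v⁻²` versus `det = P(0) ∈ ℤ`).  Argument of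
`Cruxes/PadicLimitUnrefined/Disproof.lean` (refuter rattack-stmt-Langlands-18088), re-proved with
`det_eq_sq`. [folklore] -/
theorem false_of_sympl_inv_of_integralFrobCharpoly (ρ : FramedGaloisRep ℚ (PadicAlgCl p) 4)
    (hS : ρ.IsSymplecticWithMultiplierFun (fun g => algebraMap ℚ_[p] (PadicAlgCl p)
      ((((GaloisRep.cyclotomicCharacter ℚ p g)⁻¹ : ℤ_[p]ˣ) : ℤ_[p]) : ℚ_[p])))
    {v : HeightOneSpectrum (𝓞 ℚ)} (hv : ((p : ℕ) : 𝓞 ℚ) ∉ v.asIdeal)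
    {P : ℤ[X]} (hP : ρ.HasFrobCharpolyAt v (P.map (Int.castRingHom (PadicAlgCl p)))) :
    False := by
  obtain ⟨𝔓, h𝔓⟩ := v.primesAbove_nonempty
  obtain ⟨σ, hσ⟩ := HeightOneSpectrum.exists_isArithFrobAt_of_mem_primesAbove_holds h𝔓
  have hchar : ((ρ σ : GL (Fin 4) (PadicAlgCl p)) : Matrix (Fin 4) (Fin 4) (PadicAlgCl p)).charpoly
      = P.map (Int.castRingHom (PadicAlgCl p)) := hP 𝔓 h𝔓 σ hσ
  haveI : NeZero ((p : ℕ) : ℚ) := ⟨by exact_mod_cast (Fact.out : p.Prime).ne_zero⟩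
  -- `det ρ(σ) = ν(σ)²`, `ν(σ) = ε(σ)⁻¹` read in `ℚ̄_p`
  have hdet := hS.det_eq_sq σ
  set ν : PadicAlgCl p := algebraMap ℚ_[p] (PadicAlgCl p)
      ((((GaloisRep.cyclotomicCharacter ℚ p σ)⁻¹ : ℤ_[p]ˣ) : ℤ_[p]) : ℚ_[p]) with hν
  -- `ε(σ) = q`
  have hε : ((GaloisRep.cyclotomicCharacter ℚ p σ : ℤ_[p]ˣ) : ℤ_[p]) = (v.residueCard : ℤ_[p]) :=
    GaloisRep.cyclotomicCharacter_apply_of_isArithFrobAt hv h𝔓 hσ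
  have hνq : ν * (v.residueCard : PadicAlgCl p) = 1 := by
    have h1 : (((GaloisRep.cyclotomicCharacter ℚ p σ)⁻¹ : ℤ_[p]ˣ) : ℤ_[p]) *
        (v.residueCard : ℤ_[p]) = 1 := by
      rw [← hε, Units.inv_mul]
    have h2 := congrArg (fun x : ℤ_[p] => algebraMap ℚ_[p] (PadicAlgCl p) (x : ℚ_[p])) h1
    simpa [hν] using h2
  -- `det ρ(σ) = P(0)`
  have hdetP : ((ρ σ : GL (Fin 4) (PadicAlgCl p)) : Matrix (Fin 4) (Fin 4) (PadicAlgCl p)).det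
      = ((P.coeff 0 : ℤ) : PadicAlgCl p) := by
    rw [Matrix.det_eq_sign_charpoly_coeff, Fintype.card_fin, hchar, Polynomial.coeff_map,
      eq_intCast]
    norm_num
  -- `P(0) · q² = 1` in `ℤ`
  have hC : ((P.coeff 0 : ℤ) : PadicAlgCl p) * (v.residueCard : PadicAlgCl p) ^ 2 = 1 := by
    rw [← hdetP, hdet, ← mul_pow, hνq, one_pow]
  have hZ : (P.coeff 0) * ((v.residueCard : ℕ) : ℤ) ^ 2 = 1 := by exact_mod_cast hC
  have hq : (2 : ℤ) ≤ ((v.residueCard : ℕ) : ℤ) := by exact_mod_cast v.one_lt_residueCard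
  have hunit : ((v.residueCard : ℕ) : ℤ) ^ 2 ∣ 1 := ⟨P.coeff 0, by linear_combination -hZ⟩
  have h1 : ((v.residueCard : ℕ) : ℤ) ^ 2 = 1 :=
    Int.eq_one_of_dvd_one (sq_nonneg _) hunit
  nlinarith

/-- **(ii)**: the hypotheses `Sympl ρ` (multiplier `ε⁻¹`) and `Pure ρ` of the route items are
contradictory — from the `∀ᶠ`-purity extract one place `v ∤ p` with an integral Frobenius
polynomial (the Weil-root clause and unramifiedness are not even used). [folklore] -/
theorem false_of_sympl_inv_of_pure (ρ : FramedGaloisRep ℚ (PadicAlgCl p) 4)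
    (hS : ρ.IsSymplecticWithMultiplierFun (fun g => algebraMap ℚ_[p] (PadicAlgCl p)
      ((((GaloisRep.cyclotomicCharacter ℚ p g)⁻¹ : ℤ_[p]ˣ) : ℤ_[p]) : ℚ_[p])))
    (hPure : ∀ᶠ v : HeightOneSpectrum (𝓞 ℚ) in Filter.cofinite, ρ.IsUnramifiedAt v ∧
      ∃ P : Polynomial ℤ, ρ.HasFrobCharpolyAt v (P.map (Int.castRingHom (PadicAlgCl p))) ∧
        ∀ z : ℂ, (P.map (Int.castRingHom ℂ)).IsRoot z → ‖z‖ ^ 2 = (v.residueCard : ℝ)) :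
    False := by
  haveI := infinite_heightOneSpectrum_rat
  have hp : p.Prime := Fact.out
  -- only the place `primesEquiv⁻¹ p` contains `p`
  have hfin : ∀ᶠ v : HeightOneSpectrum (𝓞 ℚ) in Filter.cofinite, ((p : ℕ) : 𝓞 ℚ) ∉ v.asIdeal := by
    refine (Set.finite_singleton
      ((Rat.HeightOneSpectrum.primesEquiv (R := 𝓞 ℚ)).symm ⟨p, hp⟩)).subset ?_
    intro v hv
    simp only [Set.mem_compl_iff, Set.mem_setOf_eq, not_not] at hv
    exact (Literature.NumberTheory.EllipticCurves.natCast_mem_asIdeal_iff_eq_primesEquiv_symm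
      v hp).mp hv
  obtain ⟨v, ⟨-, P, hP, -⟩, hv⟩ := (hPure.and hfin).exists
  exact false_of_sympl_inv_of_integralFrobCharpoly ρ hS hv hP

/-! ## §2 Repairs: R1 (cohomological shape, keep `ε⁻¹`) is STILL vacuous; R2 (multiplier `ε`) is consistent -/

/-- In the COHOMOLOGICAL Siegel shape (BCGP 2021 Def. 7.3.1 as printed, residual distinctness
dropped: diagonal `(α, β, ε⁻¹β⁻¹, ε⁻¹α⁻¹)`) the determinant on `Γ_{ℚ_v}` is `ε⁻² = (ε⁻¹)²` — the
square of the multiplier `ε⁻¹`: the repaired bracket `C′` is consistent where the original dies.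
[folklore] -/
theorem det_toLocal_of_cohomologicalSiegelShape (ρ : FramedGaloisRep ℚ (PadicAlgCl p) 4)
    (v : HeightOneSpectrum (𝓞 ℚ))
    (h : ∃ (g : Matrix.GeneralLinearGroup (Fin 4) (PadicAlgCl p))
      (α β : absoluteGaloisGroup (v.adicCompletion ℚ) →* (PadicAlgCl p)ˣ),
      (∀ τ ∈ absInertia (v.adicCompletion ℚ), α τ = 1 ∧ β τ = 1) ∧
      ∀ τ, (∀ i j : Fin 4, j < i → (g⁻¹ * ρ.toLocal v τ * g).val i j = 0) ∧
        (g⁻¹ * ρ.toLocal v τ * g).val 0 1 = 0 ∧ (g⁻¹ * ρ.toLocal v τ * g).val 2 3 = 0 ∧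
        (g⁻¹ * ρ.toLocal v τ * g).val 0 0 = α τ ∧
        (g⁻¹ * ρ.toLocal v τ * g).val 1 1 = β τ ∧
        (g⁻¹ * ρ.toLocal v τ * g).val 2 2 =
          algebraMap ℚ_[p] (PadicAlgCl p)
            ((((GaloisRep.cyclotomicCharacter (v.adicCompletion ℚ) p τ)⁻¹ : ℤ_[p]ˣ) : ℤ_[p]) :
              ℚ_[p]) * ((β τ)⁻¹ : (PadicAlgCl p)ˣ) ∧
        (g⁻¹ * ρ.toLocal v τ * g).val 3 3 =
          algebraMap ℚ_[p] (PadicAlgCl p)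
            ((((GaloisRep.cyclotomicCharacter (v.adicCompletion ℚ) p τ)⁻¹ : ℤ_[p]ˣ) : ℤ_[p]) :
              ℚ_[p]) * ((α τ)⁻¹ : (PadicAlgCl p)ˣ))
    (τ : absoluteGaloisGroup (v.adicCompletion ℚ)) :
    ((ρ.toLocal v τ : GL (Fin 4) (PadicAlgCl p)) : Matrix (Fin 4) (Fin 4) (PadicAlgCl p)).det =
      algebraMap ℚ_[p] (PadicAlgCl p)
        ((((GaloisRep.cyclotomicCharacter (v.adicCompletion ℚ) p τ)⁻¹ : ℤ_[p]ˣ) : ℤ_[p]) :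
          ℚ_[p]) ^ 2 := by
  obtain ⟨g, α, β, -, hsh⟩ := h
  obtain ⟨htri, -, -, h₀, h₁, h₂, h₃⟩ := hsh τ
  have hdet : Matrix.GeneralLinearGroup.det (ρ.toLocal v τ) =
      Matrix.GeneralLinearGroup.det (g⁻¹ * ρ.toLocal v τ * g) := by
    rw [map_mul, map_mul, map_inv, inv_mul_cancel_comm]
  have hup : ((g⁻¹ * ρ.toLocal v τ * g : GL (Fin 4) (PadicAlgCl p)) :
      Matrix (Fin 4) (Fin 4) (PadicAlgCl p)).BlockTriangular id :=
    fun i j hij => htri i j hij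
  have hval : ((ρ.toLocal v τ : GL (Fin 4) (PadicAlgCl p)) :
      Matrix (Fin 4) (Fin 4) (PadicAlgCl p)).det =
      ((g⁻¹ * ρ.toLocal v τ * g : GL (Fin 4) (PadicAlgCl p)) :
        Matrix (Fin 4) (Fin 4) (PadicAlgCl p)).det := by
    rw [← Matrix.GeneralLinearGroup.val_det_apply, ← Matrix.GeneralLinearGroup.val_det_apply, hdet]
  rw [hval, Matrix.det_of_upperTriangular hup, Fin.prod_univ_four, h₀, h₁, h₂, h₃]
  set e' : PadicAlgCl p := algebraMap ℚ_[p] (PadicAlgCl p)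
    ((((GaloisRep.cyclotomicCharacter (v.adicCompletion ℚ) p τ)⁻¹ : ℤ_[p]ˣ) : ℤ_[p]) : ℚ_[p])
    with he'
  calc (α τ : PadicAlgCl p) * β τ * (e' * ((β τ)⁻¹ : (PadicAlgCl p)ˣ)) *
        (e' * ((α τ)⁻¹ : (PadicAlgCl p)ˣ))
      = e' ^ 2 * ((α τ : PadicAlgCl p) * ((α τ)⁻¹ : (PadicAlgCl p)ˣ)) *
          ((β τ : PadicAlgCl p) * ((β τ)⁻¹ : (PadicAlgCl p)ˣ)) := by ring
    _ = e' ^ 2 := by rw [Units.mul_inv, Units.mul_inv, mul_one, mul_one]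

/-- **R1 (RETRACTED)**: `LimitClassicalUnrefined` with `PSh` replaced by the cohomological Siegel shape — diagonal `(α, β, ε⁻¹β⁻¹, ε⁻¹α⁻¹)`, zeros at
`(0,1)` and `(2,3)`, upper triangular, `α, β` unramified, NO distinctness (the hypothesis `h` of the
tree's `IsWeightTwoOrdinaryDistinguished.dual_of_cohomological` minus its residual-distinctness
conjunct), multiplier `ε⁻¹` kept.  It cures clash (i) but keeps clash (ii) (`Sympl ε⁻¹` against the
integral arithmetic-Frobenius `Pure`), so it is STILL VACUOUS (`limitClassicalUnrefinedCohomShape_vacuous`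
below) — recorded only to retract revision 1's recommendation. [cite: BoxerEtAl2021, §7.3 Definition 7.3.1] -/
def LimitClassicalUnrefinedCohomShape : Prop :=
  ∀ (p : ℕ) [Fact p.Prime], p ≠ 2 → ∀ (k : Type) [Field k] [CharP k p] [IsAlgClosed k] [TopologicalSpace k] [DiscreteTopology k] (red : Valued.integer (PadicAlgCl p) →+* k) (hcpt : Literature.NumberTheory.Automorphic.isCompact_glFiniteIntegralLevel 4 ℚ) (ι : PadicAlgCl p ≃+* ℂ), let R4 := Literature.NumberTheory.GaloisRepresentations.FramedGaloisRep ℚ (PadicAlgCl p) 4; let Pl := IsDedekindDomain.HeightOneSpectrum (NumberField.RingOfIntegers ℚ); ∀ (ρ : R4), let Sympl := fun r : R4 => r.IsSymplecticWithMultiplierFun (fun g => algebraMap ℚ_[p] (PadicAlgCl p) ((((Literature.NumberTheory.GaloisRepresentations.GaloisRep.cyclotomicCharacter ℚ p g)⁻¹ : ℤ_[p]ˣ) : ℤ_[p]) : ℚ_[p])); let PSh := fun (r : R4) (v : Pl) => ∃ (g : Matrix.GeneralLinearGroup (Fin 4) (PadicAlgCl p)) (α β : Field.absoluteGaloisGroup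 (v.adicCompletion ℚ) →* (PadicAlgCl p)ˣ), (∀ τ ∈ Literature.NumberTheory.GaloisRepresentations.absInertia (v.adicCompletion ℚ), α τ = 1 ∧ β τ = 1) ∧ ∀ τ, (∀ i j : Fin 4, j < i → (g⁻¹ * r.toLocal v τ * g).val i j = 0) ∧ (g⁻¹ * r.toLocal v τ * g).val 0 1 = 0 ∧ (g⁻¹ * r.toLocal v τ * g).val 2 3 = 0 ∧ (g⁻¹ * r.toLocal v τ * g).val 0 0 = α τ ∧ (g⁻¹ * r.toLocal v τ * g).val 1 1 = β τ ∧ (g⁻¹ * r.toLocal v τ * g).val 2 2 = algebraMap ℚ_[p] (PadicAlgCl p) ((((Literature.NumberTheory.GaloisRepresentations.GaloisRep.cyclotomicCharacter (v.adicCompletion ℚ) p τ)⁻¹ : ℤ_[p]ˣ) : ℤ_[p]) : ℚ_[p]) * ((β τ)⁻¹ : (PadicAlgCl p)ˣ) ∧ (g⁻¹ * r.toLocal v τ * g).val 3 3 = algebraMap ℚ_[p] (PadicAlgCl p) ((((Literature.NumberTheory.GaloisRepresentations.GaloisRep.cyclotomicCharacter (v.adicCompletion ℚ) p τ)⁻¹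 : ℤ_[p]ˣ) : ℤ_[p]) : ℚ_[p]) * ((α τ)⁻¹ : (PadicAlgCl p)ˣ); let Pure := fun r : R4 => ∀ᶠ v : Pl in Filter.cofinite, r.IsUnramifiedAt v ∧ ∃ P : Polynomial ℤ, r.HasFrobCharpolyAt v (P.map (Int.castRingHom (PadicAlgCl p))) ∧ ∀ z : ℂ, (P.map (Int.castRingHom ℂ)).IsRoot z → ‖z‖ ^ 2 = (v.residueCard : ℝ); let BigRes := fun r : R4 => ∃ σ : Literature.NumberTheory.GaloisRepresentations.FramedGaloisRep ℚ k 4, (∀ᶠ v : Pl in Filter.cofinite, ∃ (P : Polynomial (Valued.integer (PadicAlgCl p))) (Pb : Polynomial k), r.HasFrobCharpolyAt v (P.map (Valued.integer (PadicAlgCl p)).subtype) ∧ σ.HasFrobCharpolyAt v Pb ∧ P.map red = Pb) ∧ σ.toGaloisRep.IsIrreducible ∧ ∃ x, ((σ x).val.charpoly).Separable; let Aut := fun r : R4 => ∃ π : Literature.NumberTheory.Automorphic.CuspidalAutomorphicRepData 4 ℚ hcpt, π.1.IsLAlgebraic ∧ ∀ᶠ v : Pl in Filter.cofinite, ∃ a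 : Multiset ℂ, π.1.HasSatakeParamAt v a ∧ r.IsUnramifiedAt v ∧ r.HasFrobCharpolyAt v (Literature.NumberTheory.Automorphic.arithFrobPolyOfSatake ι v.residueCard 1 a); let Lim := fun r : R4 => ∀ m : ℕ, ∃ r' : R4, Aut r' ∧ ∀ᶠ v : Pl in Filter.cofinite, ∃ P P' : Polynomial (Valued.integer (PadicAlgCl p)), r.HasFrobCharpolyAt v (P.map (Valued.integer (PadicAlgCl p)).subtype) ∧ r'.HasFrobCharpolyAt v (P'.map (Valued.integer (PadicAlgCl p)).subtype) ∧ ∀ i : ℕ, ((p : ℕ) : Valued.integer (PadicAlgCl p)) ^ m ∣ (P - P').coeff i; ρ.toGaloisRep.IsIrreducible → Sympl ρ → (∀ v : Pl, ((p : ℕ) : NumberField.RingOfIntegers ℚ) ∈ v.asIdeal → PSh ρ v) → Pure ρ → BigRes ρ → Lim ρ → Aut ρ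


/-- R1 is still vacuous: clash (ii) survives the change of shape. [folklore] -/
theorem limitClassicalUnrefinedCohomShape_vacuous : LimitClassicalUnrefinedCohomShape := by
  intro p _ _ k _ _ _ _ _ red hcpt ι R4 Pl ρ Sympl PSh Pure BigRes Aut Lim _ hS _ hPure _ _
  exact (false_of_sympl_inv_of_pure ρ hS hPure).elim

/-- **R2 — THE RECOMMENDED REPAIR `C′`**: `LimitClassicalUnrefined` with the single change
`ε⁻¹ ↦ ε` in `Sympl` (multiplier the cyclotomic character itself: the homological convention
`ρ ≈ V_p A` that `PSh`, `Pure`, `Cong`, `BigRes`, `Aut`, `Lim` already use), everything else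
byte-identical to rev 2 of the route file; identical to `LimitClassicalUnrefinedRepaired` of the sibling
workfile `Cruxes/PadicLimitUnrefined/Disproof.lean`.  Consistency: `det = ε²` from `Sympl`
(`det_eq_sq`), from `PSh` (`det_toLocal_of_siegelShape`), and `det ρ(Frob_v) = q_v² = P(0)` —
neither witness bites.  NOT a filed item (planner's call). [cite: BoxerEtAl2021, §7.3 Definition 7.3.1; §2.1.1] -/
def LimitClassicalUnrefinedRepaired : Prop :=
  ∀ (p : ℕ) [Fact p.Prime], p ≠ 2 → ∀ (k : Type) [Field k] [CharP k p] [IsAlgClosed k] [TopologicalSpace k] [DiscreteTopology k] (red : Valued.integer (PadicAlgCl p) →+* k) (hcpt : Literature.NumberTheory.Automorphic.isCompact_glFiniteIntegralLevel 4 ℚ) (ι : PadicAlgCl p ≃+* ℂ), let R4 := Literature.NumberTheory.GaloisRepresentations.FramedGaloisRep ℚ (PadicAlgCl p) 4; let Pl := IsDedekindDomain.HeightOneSpectrum (NumberField.RingOfIntegers ℚ); ∀ (ρ : R4), let Sympl := fun r : R4 => r.IsSymplecticWithMultiplierFun (fun g => algebraMap ℚ_[p] (PadicAlgCl p) (((Literature.NumberTheory.GaloisRepresentations.GaloisRep.cyclotomicCharacter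 ℚ p g : ℤ_[p]ˣ) : ℤ_[p]) : ℚ_[p])); let PSh := fun (r : R4) (v : Pl) => ∃ (g : Matrix.GeneralLinearGroup (Fin 4) (PadicAlgCl p)) (α β : Field.absoluteGaloisGroup (v.adicCompletion ℚ) →* (PadicAlgCl p)ˣ), (∀ τ ∈ Literature.NumberTheory.GaloisRepresentations.absInertia (v.adicCompletion ℚ), α τ = 1 ∧ β τ = 1) ∧ ∀ τ, (∀ i j : Fin 4, j < i → (g⁻¹ * r.toLocal v τ * g).val i j = 0) ∧ (g⁻¹ * r.toLocal v τ * g).val 0 1 = 0 ∧ (g⁻¹ * r.toLocal v τ * g).val 2 3 = 0 ∧ (g⁻¹ * r.toLocal v τ * g).val 0 0 = algebraMap ℚ_[p] (PadicAlgCl p) (((Literature.NumberTheory.GaloisRepresentations.GaloisRep.cyclotomicCharacter (v.adicCompletion ℚ) p τ : ℤ_[p]ˣ) : ℤ_[p]) : ℚ_[p]) * α τ ∧ (g⁻¹ * r.toLocal v τ * g).val 1 1 = algebraMap ℚ_[p] (PadicAlgCl p) (((Literature.NumberTheory.GaloisRepresentations.GaloisRep.cyclotomicCharacter (v.adicCompletion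 ℚ) p τ : ℤ_[p]ˣ) : ℤ_[p]) : ℚ_[p]) * β τ ∧ (g⁻¹ * r.toLocal v τ * g).val 2 2 = ((β τ)⁻¹ : (PadicAlgCl p)ˣ) ∧ (g⁻¹ * r.toLocal v τ * g).val 3 3 = ((α τ)⁻¹ : (PadicAlgCl p)ˣ); let Pure := fun r : R4 => ∀ᶠ v : Pl in Filter.cofinite, r.IsUnramifiedAt v ∧ ∃ P : Polynomial ℤ, r.HasFrobCharpolyAt v (P.map (Int.castRingHom (PadicAlgCl p))) ∧ ∀ z : ℂ, (P.map (Int.castRingHom ℂ)).IsRoot z → ‖z‖ ^ 2 = (v.residueCard : ℝ); let BigRes := fun r : R4 => ∃ σ : Literature.NumberTheory.GaloisRepresentations.FramedGaloisRep ℚ k 4, (∀ᶠ v : Pl in Filter.cofinite, ∃ (P : Polynomial (Valued.integer (PadicAlgCl p))) (Pb : Polynomial k), r.HasFrobCharpolyAt v (P.map (Valued.integer (PadicAlgCl p)).subtype) ∧ σ.HasFrobCharpolyAt v Pb ∧ P.map red = Pb) ∧ σ.toGaloisRep.IsIrreducible ∧ ∃ x, ((σ x).val.charpoly).Separable; let Aut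 := fun r : R4 => ∃ π : Literature.NumberTheory.Automorphic.CuspidalAutomorphicRepData 4 ℚ hcpt, π.1.IsLAlgebraic ∧ ∀ᶠ v : Pl in Filter.cofinite, ∃ a : Multiset ℂ, π.1.HasSatakeParamAt v a ∧ r.IsUnramifiedAt v ∧ r.HasFrobCharpolyAt v (Literature.NumberTheory.Automorphic.arithFrobPolyOfSatake ι v.residueCard 1 a); let Lim := fun r : R4 => ∀ m : ℕ, ∃ r' : R4, Aut r' ∧ ∀ᶠ v : Pl in Filter.cofinite, ∃ P P' : Polynomial (Valued.integer (PadicAlgCl p)), r.HasFrobCharpolyAt v (P.map (Valued.integer (PadicAlgCl p)).subtype) ∧ r'.HasFrobCharpolyAt v (P'.map (Valued.integer (PadicAlgCl p)).subtype) ∧ ∀ i : ℕ, ((p : ℕ) : Valued.integer (PadicAlgCl p)) ^ m ∣ (P - P').coeff i; ρ.toGaloisRep.IsIrreducible → Sympl ρ → (∀ v : Pl, ((p : ℕ) : NumberField.RingOfIntegers ℚ) ∈ v.asIdeal → PSh ρ v) → Pure ρ → BigRes ρ → Lim ρ → Aut ρ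

/-- Consistency check for R2 at `p`: with multiplier `ε` the `GSp₄` identity gives `det = ε²`,
which is exactly what the homological shape `PSh` gives on `Γ_{ℚ_v}` (`det_toLocal_of_siegelShape`) —
the witness of §1 does not bite `C′`.  (Recorded as the implication "both determinant formulas hold
simultaneously"; no contradiction is derivable from them.) [folklore] -/
theorem repaired_det_consistent (ρ : FramedGaloisRep ℚ (PadicAlgCl p) 4)
    (hS : ρ.IsSymplecticWithMultiplierFun (fun g => algebraMap ℚ_[p] (PadicAlgCl p)
      (((GaloisRep.cyclotomicCharacter ℚ p g : ℤ_[p]ˣ) : ℤ_[p]) : ℚ_[p])))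
    (v : HeightOneSpectrum (𝓞 ℚ)) (τ : absoluteGaloisGroup (v.adicCompletion ℚ)) :
    ((ρ.toLocal v τ : GL (Fin 4) (PadicAlgCl p)) : Matrix (Fin 4) (Fin 4) (PadicAlgCl p)).det =
      algebraMap ℚ_[p] (PadicAlgCl p)
        (((GaloisRep.cyclotomicCharacter (v.adicCompletion ℚ) p τ : ℤ_[p]ˣ) : ℤ_[p]) : ℚ_[p]) ^ 2 := by
  haveI : NeZero ((p : ℕ) : ℚ) := ⟨by exact_mod_cast (Fact.out : p.Prime).ne_zero⟩
  rw [FramedGaloisRep.toLocal_apply, hS.det_eq_sq, cyclotomicCharacter_absGaloisRestrict]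

/-! ## §3 Consequences: every typed item of the route is vacuously provable

These are POSITIVE proofs of Theses decls; they are recorded here as findings (and attached to the
items as evidence) — a refuter does not land them under `Theorems/`.  They show the statements must be
RESTATED (§2), not that the route's mathematics is settled. -/

/-- `LimitClassicalUnrefined` (stmt-Langlands-18087) holds VACUOUSLY. [folklore] -/
theorem limitClassicalUnrefined_vacuous :
    Summit.Langlands.Langlands.Theses.RepeatedRootSocle.LimitClassicalUnrefined := by
  intro p _ _ k _ _ _ _ _ red hcpt ι R4 Pl ρ Sympl PSh Pure BigRes Aut Lim _ hS hP _ _ _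
  exact (false_of_sympl_inv_of_siegelShape ρ hS hP).elim

/-- The TARGET `UnrefinedWeightTwoLifting` (stmt-Langlands-18086) holds VACUOUSLY (the bracket of
`ρ₀` is already contradictory). [folklore] -/
theorem unrefinedWeightTwoLifting_vacuous :
    Summit.Langlands.Langlands.Theses.RepeatedRootSocle.UnrefinedWeightTwoLifting := by
  intro p _ _ k _ _ _ _ _ red hcpt ι R4 Pl ρ₀ ρ Sympl PSh Pure Cong BigRes Aut _ hS0 hP0 _ _ _ _ _
    _ _ _
  exact (false_of_sympl_inv_of_siegelShape ρ₀ hS0 hP0).elim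

/-- `PadicLimitUnrefined` (stmt-Langlands-18088) holds VACUOUSLY. [folklore] -/
theorem padicLimitUnrefined_vacuous :
    Summit.Langlands.Langlands.Theses.RepeatedRootSocle.PadicLimitUnrefined := by
  intro p _ _ k _ _ _ _ _ red hcpt ι R4 Pl ρ₀ ρ Sympl PSh Pure Cong BigRes Aut Lim _ hS0 hP0 _ _ _
    _ _ _ _ _
  exact (false_of_sympl_inv_of_siegelShape ρ₀ hS0 hP0).elim

end Summit.Langlands.Langlands.Cruxes.LimitClassicalUnrefined.Disproof
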